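import Summits.NavierStokesRegularity.NavierStokesRegularity.Theses.AxisymmetricExtremality
import Summits.NavierStokesRegularity.NavierStokesRegularity.Theorems.AxisymmetricSwirlRegularity

/-!
# Strategist s20-g20 (family s, independent) — typed census objects for the crux
`AxisymmetricKatoGlobal` (stmt-NavierStokesRegularity-15453).

Nothing here is a route item; these are the signatures referred to in STRATEGY-CENSUS-s20.md:

* `NoAxisymMinimalBlowup` (W1) — the threshold instance of the crux that `closes` actually consumes,
  with `noAxisymMinimalBlowup_of_crux : AxisymmetricKatoGlobal → W1` and
  `closes_threshold : MinimalDatumPFold → PFoldToAxisymmetric → W1 → NavierStokesRegularity`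
  (same three lines of logic as the route's `closes`): W1 is the strictly-weaker intermediate that
  could replace the crux in the deciding theorem.
* `SchwartzToCritical` (E1) / the conjecture leaf `AxisymmetricSwirlRegularity` (E2) — the data-class
  split `E1 → E2 → AxisymmetricKatoGlobal` (`crux_of_split`, trivial seam).
-/

namespace Summit.NavierStokesRegularity.NavierStokesRegularity.Cruxes.AxisymmetricKatoGlobal.StrategistS20g20

open Summit.NavierStokesRegularity.NavierStokesRegularity.Theses.AxisymmetricExtremality

/-- The written-out axisymmetry clause of the crux (= `IsAxisymmetric u₀` unfolded). -/
def AxisymClause (u₀ : EuclideanSpace ℝ (Fin 3) → EuclideanSpace ℝ (Fin 3)) : Prop :=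
  ∀ (θ : ℝ) (x : EuclideanSpace ℝ (Fin 3)),
    u₀ (WithLp.toLp 2 ![Real.cos θ * x 0 - Real.sin θ * x 1, Real.sin θ * x 0 + Real.cos θ * x 1, x 2]) =
      WithLp.toLp 2 ![Real.cos θ * u₀ x 0 - Real.sin θ * u₀ x 1, Real.sin θ * u₀ x 0 + Real.cos θ * u₀ x 1, u₀ x 2]

/-- W1 — threshold instance: no `Ḣ^{1/2}`-minimal blow-up datum (Rusin–Šverák set `M`) is
axisymmetric. Strictly weaker than the crux (it says nothing about non-minimal data). -/
def NoAxisymMinimalBlowup : Prop :=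
  ∀ ν : ℝ, 0 < ν →
    ∀ (u₀ : EuclideanSpace ℝ (Fin 3) → EuclideanSpace ℝ (Fin 3))
      (g : Literature.Analysis.FunctionSpaces.HomSobolev (EuclideanSpace ℝ (Fin 3)) (EuclideanSpace ℂ (Fin 3)) (1 / 2 : ℝ)),
      Literature.Analysis.FluidPDE.IsMinimalBlowupDatum ν u₀ g → AxisymClause u₀ → False

/-- The crux implies its threshold instance. -/
theorem noAxisymMinimalBlowup_of_crux (h : AxisymmetricKatoGlobal) : NoAxisymMinimalBlowup := by
  intro ν hν u₀ g hmin hax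
  obtain ⟨hL3, hrep, hdiv, -, hnot⟩ := hmin
  exact hnot (h ν hν u₀ g hL3 hrep hdiv hax)

/-- W1 already decides the route: the deciding theorem with the crux replaced by its threshold
instance (same logic as `closes`). -/
theorem closes_threshold (h₂ : MinimalDatumPFold) (h₄ : PFoldToAxisymmetric)
    (hW : NoAxisymMinimalBlowup) : NavierStokesRegularity := by
  show Literature.NS.NavierStokesExistenceSmoothR3
  intro ν hν u₀ hsm hdiv hdec
  by_contra hno
  obtain ⟨u₁, g, hmin, hax⟩ := h₄ ν hν (h₂ ν hν ⟨u₀, hsm, hdiv, hdec, hno⟩)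
  exact hW ν hν u₁ g hmin hax

/-- E1 — localisation piece of the data-class split: axisymmetric-with-swirl regularity for Clay
(smooth, rapidly decaying, finite-energy) data upgrades to the critical Kato class. This is the
axisymmetric form of the qualitative-to-critical transfer behind the OPEN
`Literature.Analysis.FluidPDE.RusinSverakQuestion`; recorded to show the split, not proposed. -/
def SchwartzToCritical : Prop :=
  Summit.NavierStokesRegularity.NavierStokesRegularity.AxisymmetricSwirlRegularity → AxisymmetricKatoGlobal

/-- D3 assembly (trivial seam, modus ponens): E1 → E2 → crux. -/
theorem crux_of_split (h₁ : SchwartzToCritical)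
    (h₂ : Summit.NavierStokesRegularity.NavierStokesRegularity.AxisymmetricSwirlRegularity) :
    AxisymmetricKatoGlobal :=
  h₁ h₂

end Summit.NavierStokesRegularity.NavierStokesRegularity.Cruxes.AxisymmetricKatoGlobal.StrategistS20g20
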